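import Literature.AnabelianGeometry.EtaleTheta.ThetaRootOrbitsMonodromyToyLoop
import Literature.AnabelianGeometry.EtaleTheta.ThetaRootOrbitsMonodromyToyCor28i
import HarnessLib

/-!
# [EtTh] Cor. 2.8 (i) at the LOOP-CUT monodromy toy (PROOF-ONLY): the typed `Cor28_i` HOLDS — all four clauses, for
# EVERY topological `Γ` — at the print-recipe datum `thetaOrbitDataLoop l hl`; a GENUINE head-matched instance of F-0640

S. Mochizuki, *The étale theta function and its Frobenioid-theoretic manifestations* [EtTh], Publ. RIMS **45**
(2009), §2 Rmk. 2.1.1 p. 36, Prop. 2.2 (i) p. 37, Def. 2.5 (i)(a) p. 39, Def. 2.7 p. 41, Cor. 2.8 (i) p. 42 (PRIMS text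
pages) [cite: MochizukiEtTh2009, Cor 2.8(i) p.42] [cite: MochizukiEtTh2009, Rmk 2.1.1 p.36].  Cell `abc-iut`, F lane
(FACT-LIST row F-0640 `ThetaOrbitData.Cor28_i`: ∀-closure REFUTED — abc-iut-w4-d051 `not_forall_cor28_i`; refuted at
the `a`-cycle-cut toy — abc-iut-f-128 `MonodromyModel.not_cor28_i`; conditional at the natural instance — abc-iut-f-193
p537653 / abc-iut-L2-t1 p516984), seat abc-iut-f-128 (gen 14); abc-iut-L2-lead custody (R1504/R1515, count-neutral).
Carrier `monodromyModelLoop l hl` and datum `thetaOrbitDataLoop l hl` (`ThetaCoversMonodromyModelLoop{Shadow,}.lean`,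
`ThetaRootOrbitsMonodromyToyLoop.lean`).

RESULT ★ `cor28_i_thetaOrbitDataLoop : (thetaOrbitDataLoop l hl).Cor28_i` (every odd `l`), by clause:
* C1 (standard type preserved) and C3 (`η̈^{Θ,ℤ×μ₂}` preserved up to order `1`, EXACTLY): as at the `a`-cycle-cut toy —
  `Π^tp_Ÿ`, `Δ_Θ` and the `Ÿ`-collections are the same, so the ARGUMENT of abc-iut-f-128's `transport_etaColl_eq` («every
  admissible `(Γ, Γ_Θ)` permutes the 2l classes») applies verbatim (restated as `transport_etaColl_eq_loop`: the two data
  are not syntactically one term) and abc-iut-w6-d051's generic `isStandardColl_transport_etaZMu2` applies as is;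
* C2 (roots, order `l`): the root collection is the set of ALL multiplicative `ξ : Π^tp_{Ÿ̲̲} → Δ_Θ`, which every
  admissible transport permutes (`transport_rootCollLoop_eq`);
* **C4 (`η̈^{Θ,l·ℤ×μ₂} = {η₀^{±1}}` preserved up to order `1`) — the clause that FAILS at the `a`-cycle-cut toy — HOLDS
  here by print's mechanism** (`cC_map_xT_eq_zero`, `transport_etaCollL_eq_loop`): a `Γ` stabilising the typed `C̲`-list
  stabilises `Π^tp_{C̲} = {d̄ ∈ {1, s}}` and `Π^tp_X`, so `Γ(ι)` is a REFLECTION `s r^j` with `l ∣ j` (Rmk. 2.1.1: only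
  translations by multiples of `l` survive in `Π_{C̲}`); applying `Γ` to `ι x₀ ι⁻¹ = x₀⁻¹` and reading the `c`-coordinate
  gives `s = −s` for the shear `s = c(Γ x₀)`, so `s = 0` (`l` odd): `Γ` acts on `Π^tp_Ÿ` WITHOUT SHEAR and carries `η₀`
  to `η₀`, `η₀⁻¹` to `η₀⁻¹`.
So the two typed rigidity predicates are TRUE at the print-recipe datum of the Def-2.5-faithful toy and FALSE at the
Def-2.5-violating one (★ p542506 / ★ p543759): the whole difference is Def. 2.5 (i)(a), which the interface `Cor28_i`
does not carry (the setting data live in §1 by design).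

HONEST LABEL (abc-iut-L2-lead R1352, verbatim, inherited): «a DESIGNED tempered toy with print's monodromy combinatorics —
loop ↦ `Δ̄^ell` (`b`-cycle), the inversion INVERTS it, unipotent monodromy `x ↦ x·z` on the `a`-cycle, `z` = cusp inertia =
`Δ̄_Θ` central; `G_K := 1`; NOT a Tate curve, NOT the tempered fundamental group of a curve; consistency ≠ faithfulness;
nothing here takes a side on anything printed.»  DEGENERATE in the `G_K`/`±1`/`μ_l` directions (standard type is
vacuous-ish at `G_K = 1`; the root collection is all roots), GENUINE in the `Γ`-quantifier and in the C4 mechanism.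
PROOF-ONLY (0 `def`, 0 `instance`, 0 notation).  A statement about OUR typed predicate at a designed toy — NOT the natural
instance `ofEmbedding` at the cover of record (conditional, (E) parked R1429), not about [EtTh] Cor. 2.8 (i) in print;
no bearing on [IUTchIII] Cor. 3.12; no side taken; typed ≠ proved; count-neutral for the L2 books.
-/

noncomputable section

namespace Literature.AnabelianGeometry.EtaleTheta.ThetaCovers.MonodromyModel

open Multiplicative HeisenbergWitness TemperedModel DihedralGroup ThetaOrbitData

variable (l : ℕ) [NeZero l] (hl : Odd l)

/-! ## 1. Transport of a single function: multiplicativity and the restriction to the cusp inertia -/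

/-- The transported function `Γ·η : g ↦ Γ_Θ⁻¹(η(Γ g))` of a multiplicative `η` is multiplicative. (toy bookkeeping for
[EtTh] Cor. 2.8 (i); no claim about print) [cite: MochizukiEtTh2009, Cor 2.8(i) p.42] -/
theorem transportFn_mul {Γ : TG l ≃ₜ* TG l} (ΓΘ : DTh l ≃* DTh l)
    (hY : (PiYddT l).map Γ.toMulEquiv.toMonoidHom = PiYddT l) {η : ↥(PiYddT l) → DTh l}
    (hmul : ∀ g h, η (g * h) = η g * η h) (g h : ↥(PiYddT l)) :
    ΓΘ.symm (η ⟨Γ ((g * h : ↥(PiYddT l)) : TG l), mem_of_map_eq (T := monodromyModelLoop l hl) hY (g * h)⟩) =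
      ΓΘ.symm (η ⟨Γ g, mem_of_map_eq (T := monodromyModelLoop l hl) hY g⟩) * ΓΘ.symm (η ⟨Γ h, mem_of_map_eq (T := monodromyModelLoop l hl) hY h⟩) := by
  rw [← map_mul ΓΘ.symm, ← hmul]
  congr 2
  apply Subtype.ext
  show Γ ((g : TG l) * h) = Γ g * Γ h
  rw [map_mul]

/-- If `Γ_Θ` is `Γ`-induced and `η|_{Δ_Θ} = [·]^σ`, then `(Γ·η)|_{Δ_Θ} = [·]^σ`. (toy bookkeeping for [EtTh] Cor. 2.8 (i);
no claim about print) [cite: MochizukiEtTh2009, Cor 2.8(i) p.42] -/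
theorem transportFn_thetaTop {Γ : TG l ≃ₜ* TG l} {ΓΘ : DTh l ≃* DTh l}
    (hind : (thetaOrbitDataLoop l hl).InducesOnTheta Γ ΓΘ)
    (hY : (PiYddT l).map Γ.toMulEquiv.toMonoidHom = PiYddT l) {η : ↥(PiYddT l) → DTh l} {σ : ℤ}
    (hres : ∀ τ : ↥(thetaTop l), η ⟨τ, thetaTop_le_PiYddT l τ.2⟩ = (QuotientGroup.mk τ : DTh l) ^ σ)
    (τ : ↥(thetaTop l)) :
    ΓΘ.symm (η ⟨Γ (τ : TG l), mem_of_map_eq (T := monodromyModelLoop l hl) hY ⟨τ, thetaTop_le_PiYddT l τ.2⟩⟩) = (QuotientGroup.mk τ : DTh l) ^ σ := by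
  obtain ⟨hΓ, hmk⟩ := hind
  have hτ' : Γ (τ : TG l) ∈ thetaTop l := hΓ.le (Subgroup.mem_map.mpr ⟨τ, τ.2, rfl⟩)
  have key : ∀ p, η ⟨Γ (τ : TG l), p⟩ = (QuotientGroup.mk (⟨Γ (τ : TG l), hτ'⟩ : ↥(thetaTop l)) : DTh l) ^ σ :=
    fun _ => hres ⟨Γ (τ : TG l), hτ'⟩
  rw [key, map_zpow]
  congr 1
  rw [MulEquiv.symm_apply_eq]
  exact (hmk τ).symm

/-! ## 2. Clauses C1, C2, C3 at the loop-cut datum (every admissible `(Γ, Γ_Θ)`) -/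

/-- **The loop-cut datum is of standard type** (as for the `a`-cycle-cut datum: `η₀|_{D = 1}` is killed by `2`).
(toy bookkeeping for [EtTh] Def. 2.7; no claim about print) [cite: MochizukiEtTh2009, Def 2.7 p.41] -/
theorem isStandard_thetaOrbitDataLoop : (thetaOrbitDataLoop l hl).IsStandard := by
  refine ⟨⊥, Set.mem_singleton _, {etaFn l 1 0}, ⟨1, 0, Or.inl rfl, rfl⟩, etaFn l 1 0, Set.mem_singleton _,
    (1 : DTh l), fun g hg => ?_⟩
  have hg1 : g = 1 := Subgroup.mem_bot.mp hg
  subst hg1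
  have hact : (thetaOrbitDataLoop l hl).act 1 (1 : DTh l) = 1 := map_one _
  rw [hact, mul_inv_cancel]
  show etaFn l 1 0 1 ^ 2 = 1
  rw [etaFn_one, one_pow]

/-- **C3 at the loop-cut datum**: every admissible `(Γ, Γ_Θ)` maps `η̈^{Θ,ℤ×μ₂}` onto itself — abc-iut-f-128's
`transport_etaColl_eq` transported along the identity of `Π^tp_Ÿ`/`Δ_Θ` (same collections, same cyclotome).
(toy bookkeeping for [EtTh] Cor. 2.8 (i); no claim about print) [cite: MochizukiEtTh2009, Cor 2.8(i) p.42] -/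
theorem transport_etaColl_eq_loop {Γ : TG l ≃ₜ* TG l} {ΓΘ : DTh l ≃* DTh l}
    (hind : (thetaOrbitDataLoop l hl).InducesOnTheta Γ ΓΘ) (hY : (PiYddT l).map Γ.toMulEquiv.toMonoidHom = PiYddT l) :
    (thetaOrbitDataLoop l hl).transport (PiYddT l) Γ hY ΓΘ (etaColl l) = etaColl l := by
  -- same argument as abc-iut-f-128's `transport_etaColl_eq` (restated: the two data are not syntactically one)
  have hsub : ∀ {Γ' : TG l ≃ₜ* TG l} {ΓΘ' : DTh l ≃* DTh l} (_ : (thetaOrbitDataLoop l hl).InducesOnTheta Γ' ΓΘ')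
      (hY' : (PiYddT l).map Γ'.toMulEquiv.toMonoidHom = PiYddT l),
      (thetaOrbitDataLoop l hl).transport (PiYddT l) Γ' hY' ΓΘ' (etaColl l) ⊆ etaColl l := by
    intro Γ' ΓΘ' hind' hY'
    rintro c ⟨c₀, hc₀, rfl⟩
    obtain ⟨η, rfl, hmul, σ, hσ, hres⟩ := (mem_etaColl_iff l c₀).mp hc₀
    beta_reduce
    rw [Set.image_singleton]
    exact (mem_etaColl_iff l _).mpr ⟨_, rfl, transportFn_mul l hl ΓΘ' hY' hmul, σ, hσ,
      transportFn_thetaTop l hl hind' hY' hres⟩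
  refine Set.Subset.antisymm (hsub hind hY) ?_
  have hY' := ThetaOrbitData.map_symm_eq (T := monodromyModelLoop l hl) (PiYddT l) hY
  have hY'' := ThetaOrbitData.map_symm_eq (T := monodromyModelLoop l hl) (PiYddT l) hY'
  have heq := (thetaOrbitDataLoop l hl).transport_symm_transport (PiYddT l) Γ.symm hY' hY'' ΓΘ.symm (etaColl l)
  intro c hc
  rw [← heq] at hc
  obtain ⟨c₁, hc₁, rfl⟩ := hc
  exact ⟨c₁, hsub hind.symm hY' hc₁, rfl⟩

/-- **C2 at the loop-cut datum (⊆)**: the transport of a multiplicative root `ξ` on `Π^tp_{Ÿ̲̲}` is multiplicative, so the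
collection of ALL roots is carried into itself. (toy bookkeeping for [EtTh] Cor. 2.8 (i); no claim about print)
[cite: MochizukiEtTh2009, Cor 2.8(i) p.42] -/
theorem transport_rootCollLoop_subset (Γ : TG l ≃ₜ* TG l) (ΓΘ : DTh l ≃* DTh l)
    (hYuu : (PiYddT l ⊓ (monodromyModelLoop l hl).tp (monodromyModelLoop l hl).PiXuu).map Γ.toMulEquiv.toMonoidHom =
      PiYddT l ⊓ (monodromyModelLoop l hl).tp (monodromyModelLoop l hl).PiXuu) :
    (thetaOrbitDataLoop l hl).transport _ Γ hYuu ΓΘ (rootCollLoop l hl) ⊆ rootCollLoop l hl := by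
  rintro c ⟨c₀, ⟨ξ, hξ, rfl⟩, rfl⟩
  beta_reduce
  rw [Set.image_singleton]
  refine ⟨_, fun g h => ?_, rfl⟩
  show ΓΘ.symm (ξ ⟨Γ ((g * h : ↥(PiYddT l ⊓ _)) : TG l), _⟩) = ΓΘ.symm (ξ ⟨Γ g, _⟩) * ΓΘ.symm (ξ ⟨Γ h, _⟩)
  rw [← map_mul ΓΘ.symm, ← hξ]
  congr 2
  apply Subtype.ext
  show Γ ((g : TG l) * h) = Γ g * Γ h
  rw [map_mul]

/-- **C2 at the loop-cut datum (=)**: every transport maps the root collection onto itself (apply `⊆` to `Γ` and `Γ⁻¹`).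
(toy bookkeeping for [EtTh] Cor. 2.8 (i); no claim about print) [cite: MochizukiEtTh2009, Cor 2.8(i) p.42] -/
theorem transport_rootCollLoop_eq (Γ : TG l ≃ₜ* TG l) (ΓΘ : DTh l ≃* DTh l)
    (hYuu : (PiYddT l ⊓ (monodromyModelLoop l hl).tp (monodromyModelLoop l hl).PiXuu).map Γ.toMulEquiv.toMonoidHom =
      PiYddT l ⊓ (monodromyModelLoop l hl).tp (monodromyModelLoop l hl).PiXuu) :
    (thetaOrbitDataLoop l hl).transport _ Γ hYuu ΓΘ (rootCollLoop l hl) = rootCollLoop l hl := by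
  refine Set.Subset.antisymm (transport_rootCollLoop_subset l hl Γ ΓΘ hYuu) ?_
  have hY' := ThetaOrbitData.map_symm_eq (T := monodromyModelLoop l hl) _ hYuu
  have hY'' := ThetaOrbitData.map_symm_eq (T := monodromyModelLoop l hl) _ hY'
  have hsub := transport_rootCollLoop_subset l hl Γ.symm ΓΘ.symm hY'
  have heq := (thetaOrbitDataLoop l hl).transport_symm_transport _ Γ.symm hY' hY'' ΓΘ.symm (rootCollLoop l hl)
  intro c hc
  rw [← heq] at hc
  obtain ⟨c₁, hc₁, rfl⟩ := hc
  exact ⟨c₁, hsub hc₁, rfl⟩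

/-! ## 3. Clause C4: a `Γ` stabilising `Π^tp_{C̲}` and `Π^tp_X` has NO SHEAR on `Π^tp_Ÿ` -/

/-- `ι = s ∈ Π^tp_{C̲} = {d̄ ∈ {1, s}}` and `ι ∉ Π^tp_X` at the loop-cut toy. (toy bookkeeping) [cite: MochizukiEtTh2009, Def 2.1 p.36] -/
theorem iotaT_mem_tp_PiCu_loop :
    iotaT l ∈ (monodromyModelLoop l hl).tp (monodromyModelLoop l hl).PiCu ∧
      iotaT l ∉ (monodromyModelLoop l hl).tp (monodromyModelLoop l hl).PiX := by
  refine ⟨?_, ?_⟩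
  · rw [tp_PiCu_loop, (mem_loop_members_iff l _).2.1]
    exact Or.inr (by rw [(iotaT_coords l).1, dihedralRed_sr, map_zero])
  · rw [tp_PiX_loop]
    exact iotaT_not_mem_comap_PhiT l

/-- **Rmk. 2.1.1 at work**: if `Γ` stabilises `Π^tp_{C̲}` and `Π^tp_X` of the loop-cut toy, then `Γ(ι)` is a REFLECTION
`s r^j` with `j ≡ 0 (mod l)`. (toy bookkeeping for [EtTh] Rmk. 2.1.1 / Cor. 2.8 (i); no claim about print)
[cite: MochizukiEtTh2009, Rmk 2.1.1 p.36] -/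
theorem map_iotaT_right_of_stab (Γ : TG l ≃ₜ* TG l)
    (hCu : ((monodromyModelLoop l hl).tp (monodromyModelLoop l hl).PiCu).map Γ.toMulEquiv.toMonoidHom =
      (monodromyModelLoop l hl).tp (monodromyModelLoop l hl).PiCu)
    (hX : ((monodromyModelLoop l hl).tp (monodromyModelLoop l hl).PiX).map Γ.toMulEquiv.toMonoidHom =
      (monodromyModelLoop l hl).tp (monodromyModelLoop l hl).PiX) :
    ∃ j : ZMod 0, (Γ (iotaT l)).1.right = sr j ∧ ZMod.castHom (dvd_zero l) (ZMod l) j = 0 := by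
  obtain ⟨hι, hιX⟩ := iotaT_mem_tp_PiCu_loop l hl
  have h1 : Γ (iotaT l) ∈ (monodromyModelLoop l hl).tp (monodromyModelLoop l hl).PiCu :=
    hCu.le (Subgroup.mem_map.mpr ⟨iotaT l, hι, rfl⟩)
  have h2 : Γ (iotaT l) ∉ (monodromyModelLoop l hl).tp (monodromyModelLoop l hl).PiX := by
    intro h
    have h' : Γ.symm (Γ (iotaT l)) ∈ (monodromyModelLoop l hl).tp (monodromyModelLoop l hl).PiX :=
      (ThetaOrbitData.map_symm_eq (T := monodromyModelLoop l hl) _ hX).le (Subgroup.mem_map.mpr ⟨Γ (iotaT l), h, rfl⟩)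
    rw [ContinuousMulEquiv.symm_apply_apply] at h'
    exact hιX h'
  rw [tp_PiCu_loop, (mem_loop_members_iff l _).2.1] at h1
  rw [tp_PiX_loop, mem_comap_PhiT_heisPiX] at h2
  rcases hd : (Γ (iotaT l)).1.right with j | j
  · exact absurd ⟨j, hd⟩ h2
  · refine ⟨j, rfl, ?_⟩
    rw [hd, dihedralRed_sr] at h1
    rcases h1 with h | h
    · rw [one_def] at h; cases h
    · injection h

omit [NeZero l] in
/-- **Conjugation by a reflection `g = (v, s r^j, e)` with `j ≡ 0 (mod l)` acts on `Π^tp_Ÿ` by `(b, c) ↦ (−b, c)`.**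
(toy bookkeeping for [EtTh] Prop. 2.2 (i) «`ι` acts by `−1` on `Δ̄^ell`, `+1` on `Δ̄_Θ`»; no claim about print)
[cite: MochizukiEtTh2009, Prop 2.2 p.37] -/
theorem conj_coords_of_sr {g : TG l} {j : ZMod 0} (hg : g.1.right = sr j)
    (hj : ZMod.castHom (dvd_zero l) (ZMod l) j = 0) {y : TG l} (hy : y ∈ PiYddT l) :
    (g * y * g⁻¹).1.right = 1 ∧ bC l (g * y * g⁻¹) = -bC l y ∧ cC l (g * y * g⁻¹) = cC l y ∧ (g * y * g⁻¹).2 = 1 := by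
  obtain ⟨hd, he⟩ := (mem_PiYddT_iff l y).mp hy
  refine ⟨?_, ?_, ?_, ?_⟩
  · rw [right_mul, right_mul, right_inv, hd, mul_one, mul_inv_cancel]
  · simp only [bC_mul, bC_inv, right_mul, hg, hd, mul_one, dihedralRed_sr, hj, eps_sr]
    ring
  · simp only [cC_mul, cC_inv, bC_inv, right_mul, hg, hd, mul_one, dihedralRed_sr, hj, eps_sr, rotIdx_sr, inv_sr]
    ring
  · rw [snd_mul, snd_mul, snd_inv, he, mul_one, mul_inv_cancel]

omit [NeZero l] in
/-- `ι x₀ ι⁻¹ = x₀⁻¹` (the inversion inverts the lift of the `a`-cycle). (toy bookkeeping) [cite: MochizukiEtTh2009, Prop 2.2 p.37] -/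
theorem iotaT_conj_xT : iotaT l * xT l * (iotaT l)⁻¹ = (xT l)⁻¹ := by
  have h := conj_coords_of_sr l (iotaT_coords l).1 (map_zero _) (xT_mem l)
  refine TG.ext l ?_ ?_ ?_ ?_
  · rw [h.1, right_inv, show (xT l).1.right = 1 from rfl, inv_one]
  · rw [h.2.1, bC_inv_of_mem l (xT_mem l)]
  · rw [h.2.2.1, cC_inv_of_mem l (xT_mem l), show cC l (xT l) = 0 from rfl, neg_zero]
  · rw [h.2.2.2, snd_inv, show (xT l).2 = 1 from rfl, inv_one]

/-- **NO SHEAR**: if `Γ` stabilises `Π^tp_{C̲}`, `Π^tp_X` and `Π^tp_Ÿ` of the loop-cut toy, then the `c`-coordinate of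
`Γ(x₀)` vanishes — `Γ(ι)` is a reflection `s r^j`, `l ∣ j`, acting by `(b, c) ↦ (−b, c)`; apply `Γ` to
`ι x₀ ι⁻¹ = x₀⁻¹`: `(−α, s) = (−α, −s)`, `2s = 0`, `s = 0` (`l` odd). (toy bookkeeping for [EtTh] Cor. 2.8 (i) «`C̲`
clause»; no claim about print) [cite: MochizukiEtTh2009, Cor 2.8(i) p.42] -/
theorem cC_map_xT_eq_zero (Γ : TG l ≃ₜ* TG l)
    (hCu : ((monodromyModelLoop l hl).tp (monodromyModelLoop l hl).PiCu).map Γ.toMulEquiv.toMonoidHom =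
      (monodromyModelLoop l hl).tp (monodromyModelLoop l hl).PiCu)
    (hX : ((monodromyModelLoop l hl).tp (monodromyModelLoop l hl).PiX).map Γ.toMulEquiv.toMonoidHom =
      (monodromyModelLoop l hl).tp (monodromyModelLoop l hl).PiX)
    (hY : (PiYddT l).map Γ.toMulEquiv.toMonoidHom = PiYddT l) : cC l (Γ (xT l)) = 0 := by
  obtain ⟨j, hj, hj0⟩ := map_iotaT_right_of_stab l hl Γ hCu hX
  have hx : Γ (xT l) ∈ PiYddT l := mem_of_map_eq (T := monodromyModelLoop l hl) hY ⟨xT l, xT_mem l⟩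
  have hconj := congrArg Γ (iotaT_conj_xT l)
  rw [map_mul, map_mul, map_inv, map_inv] at hconj
  have hc := (conj_coords_of_sr l hj hj0 hx).2.2.1
  rw [hconj, cC_inv_of_mem l hx] at hc
  -- `-c = c` ⇒ `2c = 0` ⇒ `c = 0`
  have h2' : cC l (Γ (xT l)) + cC l (Γ (xT l)) = 0 := by
    nth_rw 1 [← hc]
    rw [neg_add_cancel]
  have h2 : ((twoUnit l hl : (ZMod l)ˣ) : ZMod l) * cC l (Γ (xT l)) = (twoUnit l hl : (ZMod l)ˣ) * 0 := by
    rw [coe_twoUnit, mul_zero, two_mul, h2']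
  exact (IsUnit.mul_right_inj (twoUnit l hl).isUnit).mp h2

include hl in
/-- A multiplicative `η` on `Π^tp_Ÿ` with `η|_{Δ_Θ} = [·]` and `η(x₀) = 1` IS the toy theta class `η₀` (`l ≠ 1`). (toy
bookkeeping; no claim about print) [cite: MochizukiEtTh2009, Def 2.7 p.41] -/
theorem eq_etaFn_one_zero (hl1 : l ≠ 1) {η : ↥(PiYddT l) → DTh l} (hmul : ∀ g h, η (g * h) = η g * η h)
    (hres : ∀ τ : ↥(thetaTop l), η ⟨τ, thetaTop_le_PiYddT l τ.2⟩ = (QuotientGroup.mk τ : DTh l) ^ (1 : ℤ))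
    (hx : η ⟨xT l, xT_mem l⟩ = 1) : η = etaFn l 1 0 := by
  haveI : Fact (1 < l) := ⟨lt_of_le_of_ne (Nat.one_le_iff_ne_zero.mpr (NeZero.ne l)) (Ne.symm hl1)⟩
  obtain ⟨ε, k, hε, hk⟩ := (mem_etaColl_iff l {η}).mpr ⟨η, rfl, hmul, 1, Or.inl rfl, hres⟩
  have hηeq : η = etaFn l ε k := Set.singleton_eq_singleton_iff.mp hk
  -- `k = 0` from the value at `x₀` (coordinates `b = 1`, `c = 0`)
  have hk0 : k = 0 := by
    have h := hx
    rw [hηeq, etaFn_apply, ← thetaCoeff_one, ← ofAdd_zero] at h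
    have h' : ε * 0 + k * 1 = (0 : ZMod l) := Multiplicative.ofAdd.injective (thetaCoeff_injective l h)
    rwa [mul_zero, zero_add, mul_one] at h'
  -- `ε = 1` from the value at `z` (coordinates `b = 0`, `c = 1`): `ε = −1` would give `−1 = 1`, `2 = 0`
  have hε1 : ε = 1 := by
    rcases hε with rfl | rfl
    · rfl
    · exfalso
      have hz := hres ⟨zT l, zT_mem_thetaTop l⟩
      rw [hηeq, etaFn_apply, zpow_one, mk_eq_thetaCoeff] at hz
      have hz' : (-1) * 1 + k * 0 = (1 : ZMod l) := Multiplicative.ofAdd.injective (thetaCoeff_injective l hz)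
      rw [mul_one, mul_zero, add_zero] at hz'
      have h2 : ((twoUnit l hl : (ZMod l)ˣ) : ZMod l) = 0 := by
        rw [coe_twoUnit]
        linear_combination -hz'
      exact (twoUnit l hl).ne_zero h2
  rw [hηeq, hε1, hk0]

/-- **The transport of `η₀` along a shear-free admissible pair is `η₀`** (`Γ` stabilising `Π^tp_{C̲}`, `Π^tp_X`, `Π^tp_Ÿ`,
`Γ_Θ` induced). (toy bookkeeping for [EtTh] Cor. 2.8 (i) «`C̲` clause»; no claim about print) [cite: MochizukiEtTh2009, Cor 2.8(i) p.42] -/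
theorem transportFn_etaFn_one_zero (hl1 : l ≠ 1) {Γ : TG l ≃ₜ* TG l} {ΓΘ : DTh l ≃* DTh l}
    (hind : (thetaOrbitDataLoop l hl).InducesOnTheta Γ ΓΘ)
    (hCu : ((monodromyModelLoop l hl).tp (monodromyModelLoop l hl).PiCu).map Γ.toMulEquiv.toMonoidHom =
      (monodromyModelLoop l hl).tp (monodromyModelLoop l hl).PiCu)
    (hX : ((monodromyModelLoop l hl).tp (monodromyModelLoop l hl).PiX).map Γ.toMulEquiv.toMonoidHom =
      (monodromyModelLoop l hl).tp (monodromyModelLoop l hl).PiX)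
    (hY : (PiYddT l).map Γ.toMulEquiv.toMonoidHom = PiYddT l) :
    (fun g : ↥(PiYddT l) => ΓΘ.symm (etaFn l 1 0 ⟨Γ g, mem_of_map_eq (T := monodromyModelLoop l hl) hY g⟩)) = etaFn l 1 0 := by
  refine eq_etaFn_one_zero l hl hl1 (fun g h => transportFn_mul l hl ΓΘ hY (etaFn_mul l 1 0) g h)
    (fun τ => transportFn_thetaTop l hl hind hY (fun τ' => etaFn_apply_thetaTop l 1 0 1 (by rw [Int.cast_one]) τ') τ)
    ?_
  show ΓΘ.symm (thetaCoeff l (ofAdd (1 * cC l (Γ (xT l)) + 0 * bC l (Γ (xT l))))) = 1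
  rw [cC_map_xT_eq_zero l hl Γ hCu hX hY, mul_zero, zero_mul, add_zero, ofAdd_zero, thetaCoeff_one, map_one]

/-- … and the transport of `η₀⁻¹` is `η₀⁻¹`. (toy bookkeeping) [cite: MochizukiEtTh2009, Cor 2.8(i) p.42] -/
theorem transportFn_etaFn_neg_one_zero (hl1 : l ≠ 1) {Γ : TG l ≃ₜ* TG l} {ΓΘ : DTh l ≃* DTh l}
    (hind : (thetaOrbitDataLoop l hl).InducesOnTheta Γ ΓΘ)
    (hCu : ((monodromyModelLoop l hl).tp (monodromyModelLoop l hl).PiCu).map Γ.toMulEquiv.toMonoidHom =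
      (monodromyModelLoop l hl).tp (monodromyModelLoop l hl).PiCu)
    (hX : ((monodromyModelLoop l hl).tp (monodromyModelLoop l hl).PiX).map Γ.toMulEquiv.toMonoidHom =
      (monodromyModelLoop l hl).tp (monodromyModelLoop l hl).PiX)
    (hY : (PiYddT l).map Γ.toMulEquiv.toMonoidHom = PiYddT l) :
    (fun g : ↥(PiYddT l) => ΓΘ.symm (etaFn l (-1) 0 ⟨Γ g, mem_of_map_eq (T := monodromyModelLoop l hl) hY g⟩)) = etaFn l (-1) 0 := by
  have hneg : ∀ y, etaFn l (-1) 0 y = (etaFn l 1 0 y)⁻¹ := fun y => by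
    have h := etaFn_neg l 1 0 y
    rwa [neg_zero] at h
  funext g
  have h := congrFun (transportFn_etaFn_one_zero l hl hl1 hind hCu hX hY) g
  rw [hneg, hneg, map_inv, ← h]

omit [NeZero l] in
/-- On a carrier where all functions `Π^tp_Ÿ → Δ_Θ` coincide (the degenerate case `l = 1`), every transport is the
identity on collections. (toy bookkeeping) [cite: MochizukiEtTh2009, Cor 2.8(i) p.42] -/
theorem transport_eq_self_of_subsingleton {T : TemperedCoverData.{0} l} (O : ThetaOrbitData T) (H : Subgroup T.Gtp)
    [Subsingleton (↥H → O.DeltaTheta)] (Γ : T.Gtp ≃ₜ* T.Gtp) (hH : H.map Γ.toMulEquiv.toMonoidHom = H)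
    (ΓΘ : O.DeltaTheta ≃* O.DeltaTheta) (C : Set (Set (↥H → O.DeltaTheta))) : O.transport H Γ hH ΓΘ C = C := by
  unfold ThetaOrbitData.transport
  conv_rhs => rw [← Set.image_id C]
  refine Set.image_congr' fun c => ?_
  conv_rhs => rw [id, ← Set.image_id c]
  exact Set.image_congr' fun η => Subsingleton.elim _ _

/-- **C4 at the loop-cut datum**: a `Γ` stabilising `Π^tp_{C̲}`, `Π^tp_X`, `Π^tp_Ÿ` (with `Γ_Θ` induced) carries
`η̈^{Θ,l·ℤ×μ₂} = {η₀, η₀⁻¹}` onto itself EXACTLY. (toy bookkeeping for [EtTh] Cor. 2.8 (i) «`C̲` clause»; no claim about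
print) [cite: MochizukiEtTh2009, Cor 2.8(i) p.42] -/
theorem transport_etaCollL_eq_loop {Γ : TG l ≃ₜ* TG l} {ΓΘ : DTh l ≃* DTh l}
    (hind : (thetaOrbitDataLoop l hl).InducesOnTheta Γ ΓΘ)
    (hCu : ((monodromyModelLoop l hl).tp (monodromyModelLoop l hl).PiCu).map Γ.toMulEquiv.toMonoidHom =
      (monodromyModelLoop l hl).tp (monodromyModelLoop l hl).PiCu)
    (hX : ((monodromyModelLoop l hl).tp (monodromyModelLoop l hl).PiX).map Γ.toMulEquiv.toMonoidHom =
      (monodromyModelLoop l hl).tp (monodromyModelLoop l hl).PiX)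
    (hY : (PiYddT l).map Γ.toMulEquiv.toMonoidHom = PiYddT l) :
    (thetaOrbitDataLoop l hl).transport (PiYddT l) Γ hY ΓΘ (etaCollL l) = etaCollL l := by
  by_cases hl1 : l = 1
  · -- degenerate `l = 1`: `Δ_Θ` is a point
    subst hl1
    haveI : Subsingleton (Multiplicative (ZMod 1)) := ⟨fun a b => Multiplicative.toAdd.injective (Subsingleton.elim _ _)⟩
    haveI : Subsingleton (DTh 1) := (thetaCoeff_surjective 1).subsingleton
    exact transport_eq_self_of_subsingleton 1 (thetaOrbitDataLoop 1 hl) (PiYddT 1) Γ hY ΓΘ (etaCollL 1)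
  · unfold ThetaOrbitData.transport etaCollL
    rw [Set.image_insert_eq, Set.image_singleton]
    rw [Set.image_singleton, Set.image_singleton, transportFn_etaFn_one_zero l hl hl1 hind hCu hX hY,
      transportFn_etaFn_neg_one_zero l hl hl1 hind hCu hX hY]

/-! ## 4. The typed Cor. 2.8 (i) HOLDS at the loop-cut datum -/

/-- **★ F-0640 GENUINE INSTANCE: the typed [EtTh] Cor. 2.8 (i) `ThetaOrbitData.Cor28_i` HOLDS at the print-recipe orbit datum
of the LOOP-CUT monodromy toy**, every odd `l`, all four clauses, for EVERY topological automorphism `Γ` of `Π^tp_C` and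
every `Γ_Θ` it induces: C1 standard type preserved (abc-iut-w6-d051's generic transport), C2 roots preserved (all `l`-th
roots form one transport-stable collection), C3 `η̈^{Θ,ℤ×μ₂}` preserved exactly (abc-iut-f-128's `transport_etaColl_eq`),
C4 `η̈^{Θ,l·ℤ×μ₂}` preserved exactly (`transport_etaCollL_eq_loop`: a `Γ` stabilising the typed `C̲`-list sends `ι` to a
reflection `s r^j`, `l ∣ j`, hence has no shear).  Contrast ★ `not_cor28_i` at the `a`-cycle-cut toy: the difference is
Def. 2.5 (i)(a) alone.  HONEST LABEL: R1352 DESIGNED TOY; DEGENERATE in the `G_K`/`±1`/`μ_l` directions; an instance of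
OUR typed predicate — not the natural instance at the cover of record (conditional, (E) parked), not [EtTh] Cor. 2.8 (i)
in print; no side taken; typed ≠ proved. [cite: MochizukiEtTh2009, Cor 2.8(i) p.42] -/
theorem cor28_i_thetaOrbitDataLoop : (thetaOrbitDataLoop l hl).Cor28_i := by
  intro _ Γ ΓΘ hind hD hY hYuu
  refine ⟨(thetaOrbitDataLoop l hl).isStandardColl_transport_etaZMu2 (Set.finite_singleton _)
      (isStandard_thetaOrbitDataLoop l hl) hind hD hY,
    fun _ => EqUpToRootOfUnity.of_eq (transport_rootCollLoop_eq l hl Γ ΓΘ hYuu),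
    fun _ => EqUpToRootOfUnity.of_eq (transport_etaColl_eq_loop l hl hind hY), fun hlist => ?_⟩
  exact EqUpToRootOfUnity.of_eq (transport_etaCollL_eq_loop l hl hind
    (hlist _ (List.mem_cons_self)) (hlist _ (by simp)) hY)

/-- **Both typed verdicts over the SAME `Π^tp_C`, `Π^tp_Ÿ`, `Δ_Θ` and the SAME print-recipe `Ÿ`-collections**: the typed
Cor. 2.8 (i) HOLDS at the loop-cut toy (Def. 2.5 (i)(a) true) and FAILS at the `a`-cycle-cut toy (Def. 2.5 (i)(a) false,
`l ≠ 1`). [cite: MochizukiEtTh2009, Cor 2.8(i) p.42] -/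
theorem cor28_i_loop_and_not_cor28_i_acycle (hl1 : l ≠ 1) :
    (thetaOrbitDataLoop l hl).Cor28_i ∧ ¬ (thetaOrbitData l hl).Cor28_i ∧
      (monodromyModelLoop l hl).Def25Conditions (fun _ => True) ∧
      ¬ (monodromyModel l hl).Def25Conditions (fun _ => True) :=
  ⟨cor28_i_thetaOrbitDataLoop l hl, not_cor28_i l hl hl1, def25Conditions_monodromyModelLoop l hl,
    not_def25Conditions l hl hl1 _⟩

end Literature.AnabelianGeometry.EtaleTheta.ThetaCovers.MonodromyModel

end
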